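import Literature.Geometry.DiscreteGeometry.ThreePointKernelDimThree
import Summits.Ventures.PackingBounds.Energy.FivePointRieszEightFacc2
import Summits.Ventures.PackingBounds.Energy.FivePointRieszEightFgrp3
import Summits.Ventures.PackingBounds.Energy.FivePointRieszEightFblk0
import Summits.Ventures.PackingBounds.Energy.FivePointRieszEightFblk1
import Summits.Ventures.PackingBounds.Energy.FivePointRieszEightFblk2
import Summits.Ventures.PackingBounds.Energy.FivePointRieszEightFblk3
import Summits.Ventures.PackingBounds.Energy.FivePointRieszEightFblk4
import Summits.Ventures.PackingBounds.Energy.FivePointRieszEightFblk5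
import Summits.Ventures.PackingBounds.Energy.FivePointRieszEightFblk6
import Summits.Ventures.PackingBounds.Energy.FivePointRieszEightFblk7
import HarnessLib

/-!
# `FivePointRieszEight`: the tree's factored three-point function `threePointF3 8 8 dcoKR8 gwKR8` equals the expansion `FexpKR8`

Framing: lottery ticket; floor = certified bounds/negative ranges. Venture `PackingBounds`, cell
`pub-packcert`, energy family E3PT (pub-packcert-energy gen 15/17; n = 3, d = 8 kernel route = KERNEL-D6 double data route, size-split).
-/

noncomputable section

open Finset

namespace Summit.Ventures.PackingBounds.Energy.FivePointRieszEight

open Literature.Geometry.DiscreteGeometry Literature.Geometry.DiscreteGeometry.BachocVallentin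
open Literature.Analysis.SpecialFunctions

/-- `Σ_{k<8} f k` written out. -/
private theorem sum_range_blocksR8 (f : ℕ → ℝ) : ∑ k ∈ range 8, f k = f 0 + f 1 + f 2 + f 3 + f 4 + f 5 + f 6 + f 7 := by
  simp [Finset.sum_range_succ]

set_option maxRecDepth 20000 in
set_option maxHeartbeats 400000000 in
/-- The last staged partial sum lands on `FexpKR8` (`ring`). -/
theorem fgrp_top_eqR8 (u v t : ℝ) : Facc2KR8 u v t + Fgrp3KR8 u v t = FexpKR8 u v t := by
  unfold Facc2KR8 Facc2K_c0R8 Facc2K_c1R8 Facc2K_c2R8 Facc2K_c3R8 Facc2K_c4R8 Facc2K_c5R8 Fgrp3KR8 Fgrp3K_c0R8 Fgrp3K_c1R8 Fgrp3K_c2R8 Fgrp3K_c3R8 Fgrp3K_c4R8 Fgrp3K_c5R8 FexpKR8 FexpK_c0R8 FexpK_c1R8 FexpK_c2R8 FexpK_c3R8 FexpK_c4R8 FexpK_c5R8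
  ring

/-- The tree's factored three-point function (`ThreePointKernelDimThree.threePointF3`, `n = 3`) equals `FexpKR8` (blockwise identities
`fblk<k>_eq`, staged sums, `linear_combination`). -/
theorem threePointF3_eqR8 (u v t : ℝ) : threePointF3 8 8 dcoKR8 gwKR8 u v t = FexpKR8 u v t := by
  rw [threePointF3, sum_range_blocksR8, fblk0_eqR8, fblk1_eqR8, fblk2_eqR8, fblk3_eqR8, fblk4_eqR8, fblk5_eqR8, fblk6_eqR8, fblk7_eqR8]
  linear_combination fgrp0_eqR8 u v t + fgrp1_eqR8 u v t + fgrp2_eqR8 u v t + fgrp3_eqR8 u v t + facc1_eqR8 u v t + facc2_eqR8 u v t + fgrp_top_eqR8 u v t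

end Summit.Ventures.PackingBounds.Energy.FivePointRieszEight
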